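import Mathlib.Tactic.DeriveFintype
import Mathlib.Algebra.Group.Defs
import HarnessLib

/-!
# Venture HSemireg — kernel index of the slot-frame arithmetic (SLOT-ORBIT-w1aut1 §1–§3)

Bookkeeping of the computation cell `pub-hsemireg`, seat w1-aut-1 (note
`widen/W1/SLOT-ORBIT-w1aut1.md` v1.2.1, scripts `widen/W1/w1aut1/slotorbit/`). The Néron–Severi
group of `S = E_ω × E_ω` (`E_ω = ℂ/ℤ[ω]`) is identified there with the 2×2 Hermitian matrices over
`ℤ[ω]`; `χ(L) = det`, `L·L′ = det(M+M′) − det M − det M′`; the axis curves are `p ↔ diag(1,0)`,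
`q ↔ diag(0,1)`, the graph `Γ(f) = {y = f x}` ↔ `[[N f, −f̄],[−f, 1]]`, and a group automorphism
`g ∈ GL₂(ℤ[ω])` acts by `M ↦ g† M g`.  This file re-does, IN THE KERNEL, the finite arithmetic behind:

* the HEXAGON LAW (§1 (1d)): the unit graphs `Γ(ζ^k)`, `ζ = 1 + ω`, meet pairwise in `1, 3, 4`
  points for `|i − j| = 1, 2, 3 (mod 6)`, and each meets `p` and `q` once;
* LEMMA P at the Néron–Severi level (§2): `c_z − p − q` equals the difference of two ADJACENT unit
  graphs, in both hexagon-edge forms, for `z = 0, 1, 2`; `Γ(u) + Γ(−u) = 2(p+q)`; `H − 𝒫_z = Γ(−ω^z)`;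
* COROLLARY P-BOX (§2): for the explicit automorphisms `α_z` (columns `(1, ζ^{2z−1})`, `(1, ζ^{2z−2})`,
  unit determinant) `α_z† · M(𝒫_z) · α_z = diag(−1, 1)` — the Poincaré-type class is a BOX class of
  bidegree `(−1, +1)` in that frame;
* the value-gcd certificate of PROPOSITION BOX for the square-`−6` class `𝒫₀ − 𝒫₁` (§3): its
  diagonal entries vanish and the traces of `m₁₂·{1, ω, ω̄}` are all divisible by `3`, while a box
  class `diag(m, n)` with `m n = −3` represents `±1`.

Everything is decided by `decide` on integer pairs; ℤ[ω] is modelled as pairs `(a, b) = a + bω` with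
`ω² = −1 − ω`.  HONEST FRAMING: finite integer arithmetic only — the dictionary «Hermitian matrix ↔
line bundle», the seesaw step of LEMMA P and every statement about sheaves, A∞-structures or the
semiregularity map live in the note, not here.  Nothing in this file says that HC, HC_CM or HC_AV
holds, and nothing here is a new case of anything.
-/

namespace Summit.Ventures.HSemireg

namespace SlotFrameHexagon

/-- Eisenstein integers as pairs: `⟨a, b⟩ = a + b ω`, `ω² = −1 − ω`. -/
structure Eis where
  /-- coefficient of `1` -/
  a : ℤ
  /-- coefficient of `ω` -/
  b : ℤ
deriving DecidableEq, Repr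

namespace Eis

/-- addition -/
def add (x y : Eis) : Eis := ⟨x.a + y.a, x.b + y.b⟩
/-- negation -/
def neg (x : Eis) : Eis := ⟨-x.a, -x.b⟩
/-- subtraction -/
def sub (x y : Eis) : Eis := add x (neg y)
/-- multiplication: `(a + bω)(c + dω) = (ac − bd) + (ad + bc − bd) ω` -/
def mul (x y : Eis) : Eis := ⟨x.a * y.a - x.b * y.b, x.a * y.b + x.b * y.a - x.b * y.b⟩
/-- complex conjugation: `conj (a + bω) = (a − b) − b ω` -/
def conj (x : Eis) : Eis := ⟨x.a - x.b, -x.b⟩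
/-- the norm `x · conj x` (an integer) -/
def norm (x : Eis) : ℤ := x.a * x.a - x.a * x.b + x.b * x.b
/-- the trace `x + conj x` (an integer) -/
def tr (x : Eis) : ℤ := 2 * x.a - x.b
/-- `0, 1, ω` -/
def zero : Eis := ⟨0, 0⟩
/-- the unit `1` -/
def one : Eis := ⟨1, 0⟩
/-- `ω` -/
def om : Eis := ⟨0, 1⟩
/-- `ω̄ = ω² = −1 − ω` -/
def omb : Eis := ⟨-1, -1⟩
/-- `ζ = 1 + ω = −ω̄`, a primitive sixth root of unity -/
def zeta : Eis := ⟨1, 1⟩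
/-- `ζ^k` by iterated multiplication -/
def zpow : ℕ → Eis
  | 0 => one
  | k + 1 => mul (zpow k) zeta

/-- `norm x · 1 = x · conj x` (sanity of the closed forms, on the six units and a few more). -/
theorem norm_mul_conj_check :
    (([one, om, omb, zeta, ⟨2, 1⟩, ⟨-3, 2⟩, ⟨1, -2⟩] : List Eis).map
      fun x => decide (mul x (conj x) = ⟨norm x, 0⟩ ∧ add x (conj x) = ⟨tr x, 0⟩)) =
      [true, true, true, true, true, true, true] := by decide

/-- The six powers of `ζ` are `1, 1+ω, ω, −1, −1−ω, −ω` and `ζ⁶ = 1`. -/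
theorem zpow_table :
    (List.range 7).map zpow = [one, ⟨1, 1⟩, om, ⟨-1, 0⟩, omb, ⟨0, -1⟩, one] := by decide

end Eis

open Eis

/-- A 2×2 Hermitian matrix over ℤ[ω]: `[[m11, m12],[conj m12, m22]]` with integer diagonal. -/
structure Herm where
  /-- top-left entry (an integer) -/
  m11 : ℤ
  /-- top-right entry -/
  m12 : Eis
  /-- bottom-right entry (an integer) -/
  m22 : ℤ
deriving DecidableEq, Repr

namespace Herm

/-- sum -/
def add (A B : Herm) : Herm := ⟨A.m11 + B.m11, Eis.add A.m12 B.m12, A.m22 + B.m22⟩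
/-- difference -/
def sub (A B : Herm) : Herm := ⟨A.m11 - B.m11, Eis.sub A.m12 B.m12, A.m22 - B.m22⟩
/-- integer multiple -/
def smul (k : ℤ) (A : Herm) : Herm := ⟨k * A.m11, ⟨k * A.m12.a, k * A.m12.b⟩, k * A.m22⟩
/-- determinant `m11 m22 − N(m12)` (= `χ` of the line bundle) -/
def det (A : Herm) : ℤ := A.m11 * A.m22 - Eis.norm A.m12
/-- intersection pairing `det(A+B) − det A − det B` -/
def dot (A B : Herm) : ℤ := det (add A B) - det A - det B
/-- the rank-one form `ψ† ψ` of a row `ψ = (s, t)`: the class of the sub-torus `ker ψ` -/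
def rank1 (s t : Eis) : Herm := ⟨Eis.norm s, Eis.mul (Eis.conj s) t, Eis.norm t⟩
/-- `p = {x = 0}` -/
def P : Herm := ⟨1, Eis.zero, 0⟩
/-- `q = {y = 0}` -/
def Q : Herm := ⟨0, Eis.zero, 1⟩
/-- `H = p + q` -/
def HH : Herm := ⟨1, Eis.zero, 1⟩
/-- the graph `Γ(f) = {y = f x} = ker(−f, 1)` -/
def Gam (f : Eis) : Herm := rank1 (Eis.neg f) Eis.one
/-- `c_z = Γ(ω^z)` for `z = 0, 1, 2` -/
def c (z : ℕ) : Herm := Gam (zpow (2 * z))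
/-- `𝒫_z = c_z − p − q` -/
def Pz (z : ℕ) : Herm := sub (sub (c z) P) Q

/-- A 2×2 matrix over ℤ[ω] (an endomorphism / automorphism of `S`), by its four entries. -/
structure Mat where
  /-- entries -/
  (e11 e12 e21 e22 : Eis)
deriving DecidableEq, Repr

/-- determinant of a 2×2 matrix over ℤ[ω] -/
def Mat.det (g : Mat) : Eis := Eis.sub (Eis.mul g.e11 g.e22) (Eis.mul g.e12 g.e21)

/-- The congruence action `A ↦ g† A g`, written out entrywise; the result is returned as a
Hermitian triple together with the two checks that it IS Hermitian (integer diagonal). -/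
def congr (g : Mat) (A : Herm) : Herm × Bool :=
  -- A as a full matrix
  let a11 : Eis := ⟨A.m11, 0⟩
  let a12 : Eis := A.m12
  let a21 : Eis := Eis.conj A.m12
  let a22 : Eis := ⟨A.m22, 0⟩
  -- B = A g
  let b11 := Eis.add (Eis.mul a11 g.e11) (Eis.mul a12 g.e21)
  let b12 := Eis.add (Eis.mul a11 g.e12) (Eis.mul a12 g.e22)
  let b21 := Eis.add (Eis.mul a21 g.e11) (Eis.mul a22 g.e21)
  let b22 := Eis.add (Eis.mul a21 g.e12) (Eis.mul a22 g.e22)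
  -- R = g† B, g† = [[conj e11, conj e21],[conj e12, conj e22]]
  let r11 := Eis.add (Eis.mul (Eis.conj g.e11) b11) (Eis.mul (Eis.conj g.e21) b21)
  let r12 := Eis.add (Eis.mul (Eis.conj g.e11) b12) (Eis.mul (Eis.conj g.e21) b22)
  let r21 := Eis.add (Eis.mul (Eis.conj g.e12) b11) (Eis.mul (Eis.conj g.e22) b21)
  let r22 := Eis.add (Eis.mul (Eis.conj g.e12) b12) (Eis.mul (Eis.conj g.e22) b22)
  (⟨r11.a, r12, r22.a⟩, decide (r11.b = 0 ∧ r22.b = 0 ∧ r21 = Eis.conj r12))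

end Herm

open Herm

/-! ## §1 (1c)–(1d): intersections of the named curves; the hexagon law -/

/-- `p² = q² = 0`, `p·q = 1`, `H² = 2`, and every unit graph `Γ(ζ^k)` is a square-zero class
meeting `p` and `q` once. -/
theorem axes_and_unit_graphs :
    dot P P = 0 ∧ dot Q Q = 0 ∧ dot P Q = 1 ∧ dot HH HH = 2 ∧
    ((List.range 6).map fun k => (det (Gam (zpow k)), dot (Gam (zpow k)) P, dot (Gam (zpow k)) Q))
      = List.replicate 6 (0, 1, 1) := by decide

/-- HEXAGON LAW: `Γ(ζ^i)·Γ(ζ^j) = 1, 3, 4` for `j − i ≡ ±1, ±2, 3 (mod 6)` (the full 6×6 table). -/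
theorem hexagon_table :
    ((List.range 6).map fun i => (List.range 6).map fun j => dot (Gam (zpow i)) (Gam (zpow j)))
      = [[0, 1, 3, 4, 3, 1], [1, 0, 1, 3, 4, 3], [3, 1, 0, 1, 3, 4],
         [4, 3, 1, 0, 1, 3], [3, 4, 3, 1, 0, 1], [1, 3, 4, 3, 1, 0]] := by decide

/-! ## §2: LEMMA P at the Néron–Severi level, and COROLLARY P-BOX -/

/-- The three Poincaré-type classes have square `−2` and are orthogonal to `p`, `q`, `H`;
`𝒫₀ + 𝒫₁ + 𝒫₂ = 0`; `𝒫_z·𝒫_{z′} = 1`. -/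
theorem poincare_classes :
    ((List.range 3).map fun z => (2 * det (Pz z), dot (Pz z) P, dot (Pz z) Q, dot (Pz z) HH))
      = List.replicate 3 (-2, 0, 0, 0) ∧
    Herm.add (Herm.add (Pz 0) (Pz 1)) (Pz 2) = ⟨0, Eis.zero, 0⟩ ∧
    dot (Pz 0) (Pz 1) = 1 ∧ dot (Pz 1) (Pz 2) = 1 ∧ dot (Pz 0) (Pz 2) = 1 := by decide

/-- LEMMA P (NS level), both hexagon-edge forms: `𝒫_z = Γ(ζ^{2z−1}) − Γ(ζ^{2z−2})
= Γ(ζ^{2z+1}) − Γ(ζ^{2z+2})` for `z = 0, 1, 2` (exponents mod 6), the two graphs of each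
difference being ADJACENT (one intersection point). -/
theorem lemmaP_ns :
    ((List.range 3).map fun z =>
      ( decide (Pz z = Herm.sub (Gam (zpow ((2 * z + 5) % 6))) (Gam (zpow ((2 * z + 4) % 6)))),
        decide (Pz z = Herm.sub (Gam (zpow ((2 * z + 1) % 6))) (Gam (zpow ((2 * z + 2) % 6)))),
        dot (Gam (zpow ((2 * z + 5) % 6))) (Gam (zpow ((2 * z + 4) % 6))),
        dot (Gam (zpow ((2 * z + 1) % 6))) (Gam (zpow ((2 * z + 2) % 6))) ))
      = List.replicate 3 (true, true, 1, 1) := by decide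

/-- Antipodal sums and the `H` identities: `Γ(ζ^k) + Γ(ζ^{k+3}) = 2H`,
`H − 𝒫_z = Γ(−ω^z) = Γ(ζ^{2z+3})` (HANDCERT LEMMA A(b) at NS level), and
`H = Γ(ζ^{2k−1}) − Γ(ζ^{2k}) + Γ(ζ^{2k+1})`. -/
theorem H_identities :
    ((List.range 3).map fun k => decide (Herm.add (Gam (zpow k)) (Gam (zpow (k + 3))) = smul 2 HH))
      = [true, true, true] ∧
    ((List.range 3).map fun z => decide (Herm.sub HH (Pz z) = Gam (zpow ((2 * z + 3) % 6))))
      = [true, true, true] ∧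
    ((List.range 3).map fun k => decide
      (Herm.add (Herm.sub (Gam (zpow ((2 * k + 5) % 6))) (Gam (zpow ((2 * k) % 6))))
        (Gam (zpow ((2 * k + 1) % 6))) = HH)) = [true, true, true] := by decide

/-- The explicit frame automorphism `α_z`: columns `(1, ζ^{2z−1})`, `(1, ζ^{2z−2})`. -/
def alpha (z : ℕ) : Mat := ⟨Eis.one, Eis.one, zpow ((2 * z + 5) % 6), zpow ((2 * z + 4) % 6)⟩

/-- COROLLARY P-BOX (NS level): `det α_z` is a unit (norm 1) and `α_z† · M(𝒫_z) · α_z = diag(−1, 1)`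
(a genuine Hermitian result), for `z = 0, 1, 2`. -/
theorem pbox :
    ((List.range 3).map fun z => (Eis.norm (Mat.det (alpha z)), congr (alpha z) (Pz z)))
      = List.replicate 3 (1, (⟨-1, Eis.zero, 1⟩, true)) := by decide

/-- In the frame `α₀` the other letters are NOT box: the images of `p`, `q`, `𝒫₁`, `𝒫₂`, `H`
all have a non-zero off-diagonal entry (printed for the record). -/
theorem alpha0_images :
    ([P, Q, Pz 1, Pz 2, HH].map fun A => congr (alpha 0) A) =
      [ (⟨1, ⟨1, 0⟩, 1⟩, true), (⟨1, ⟨0, -1⟩, 1⟩, true), (⟨2, ⟨1, -1⟩, 1⟩, true),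
        (⟨-1, ⟨-1, 1⟩, -2⟩, true), (⟨2, ⟨1, -1⟩, 2⟩, true) ] := by decide

/-! ## §3: the value-gcd certificate for the square-(−6) class `𝒫₀ − 𝒫₁` -/

/-- `𝒫₀ − 𝒫₁` has square `−6`, zero diagonal, and the traces of `m₁₂`, `m₁₂ ω`, `m₁₂ ω̄` are
`−3, 3, 0` — all divisible by `3`; hence every value `v† M v = N(v₁) m₁₁ + N(v₂) m₂₂ +
Tr(v̄₁ m₁₂ v₂)` is divisible by `3`, whereas a box class `diag(m, n)` with `m n = −3` represents
`m ∈ {±1, ±3}` and `n = −3/m`, one of which is `±1`.  So `𝒫₀ − 𝒫₁` lies in no frame. -/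
theorem square_minus_six_certificate :
    let D := Herm.sub (Pz 0) (Pz 1)
    2 * det D = -6 ∧ D.m11 = 0 ∧ D.m22 = 0 ∧
    (Eis.tr D.m12, Eis.tr (Eis.mul D.m12 Eis.om), Eis.tr (Eis.mul D.m12 Eis.omb)) = (-3, 3, 0) ∧
    (∀ m ∈ ([1, -1, 3, -3] : List ℤ), m * (-3 / m) = -3 ∧ (m = 1 ∨ m = -1 ∨ -3 / m = 1 ∨ -3 / m = -1))
    := by decide

end SlotFrameHexagon

end Summit.Ventures.HSemireg
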